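import Summits.ValiantsHypothesis.ValiantsHypothesis.Theorems.PerDivisionHard.Negative.PerLowDegreeRung
import Literature.Computability.AlgebraicComplexity.PermanentIrreducible

/-!
# Crux `DivisionGap.PerDivisionHard` (stmt-ValiantsHypothesis-5065), line `pair-descent-jss-endpoint` —
stub `stub_blockArsenal`, part Aux: the vocabulary-free half

Two ingredients of the unconditional arsenal of the line that do not mention the block graph:

* `complexity_gt_of_perSupport_projection` — if a polynomial `p` in the `n × n` matrix variables
  has a projection `q` (variables ↦ variables or constants) whose SUPPORT is that of `per_b`, and
  `b ≥ (log₂ n + d)^d` with `d = c + 3κ + 7`, then `((n+2)(2^{(log₂ n + c)^c} + 3))^κ < L(p)`: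
  projections are free (`complexity_le_of_isProjection`), Jerrum–Snir by support
  (`two_pow_le_complexity_of_support_eq_perPoly`: `2^{b/3} ≤ L(q)` for `b ≥ 6`), and the
  natural-number bookkeeping `((n+2)(2^B+3))^κ ≤ 2^{κ(B + log₂ n + 4)} < 2^{b/3}`
  (`arsenal_arith`).
* `support_sum_prod_X_eq_perPoly` — a sum `Σ_{s ∈ S} ∏_i X_{(i, F s i)}` over `ℝ≥0` in which every
  `F s` is a bijection and every permutation occurs as some `F s` has the support of the permanent
  (no cancellation over `ℝ≥0`; coefficients are irrelevant).

The block-graph combinatorics (phase bijection) and the final `stub_blockArsenal` are in the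
sibling parts `…StubBlockArsenalPhase.lean` / `…StubBlockArsenal.lean`.
-/

noncomputable section

-- `Summit.ValiantsHypothesis.ValiantsHypothesis.…` is the tree's mandated single-conjunct layout
-- (Sub = Summit), so the duplicated namespace component is intended.
set_option linter.dupNamespace false

namespace Summit.ValiantsHypothesis.ValiantsHypothesis.Theorems.DivisionGapPerDivisionHard

open MvPolynomial Literature.Computability.AlgebraicComplexity
open Summit.ValiantsHypothesis.ValiantsHypothesis.Theorems.PerDivisionHard.Negative
open Summit.ValiantsHypothesis.ValiantsHypothesis.Theorems.ZeroOneTransfer.Negative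
  (support_sum_monomial_one)
open scoped NNReal

/-! ### Arithmetic: `((n+2)(2^B+3))^κ < 2^{b/3}` for `b ≥ (log₂ n + d)^d`, `d = c + 3κ + 7` -/

/-- The polynomial comparison behind the choice `d = c + 3κ + 7`:
`3 (κ (L + (L+c)^c + 4) + 1) ≤ (L+c)^c · (L + d)²`. [folklore] -/
theorem arsenal_key_ineq (L c κ : ℕ) :
    ((L + (L + c) ^ c + 4) * κ + 1) * 3 ≤ (L + c) ^ c * (L + (c + 3 * κ + 7)) ^ 2 := by
  have hP : 1 ≤ (L + c) ^ c := by
    rcases Nat.eq_zero_or_pos c with rfl | hc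
    · simp
    · exact Nat.one_le_pow _ _ (by omega)
  obtain ⟨p, hp⟩ : ∃ p, (L + c) ^ c = p + 1 := ⟨(L + c) ^ c - 1, by omega⟩
  rw [hp]
  nlinarith [Nat.zero_le (p * L * κ), Nat.zero_le (p * κ), Nat.zero_le (p * L), Nat.zero_le p,
    Nat.zero_le (L * κ), Nat.zero_le (c * κ), Nat.zero_le (p * c), Nat.zero_le (p * c * κ),
    Nat.zero_le (p * κ * κ), Nat.zero_le (κ * κ), Nat.zero_le (L * L), Nat.zero_le (c * c),
    Nat.zero_le (p * L * L), Nat.zero_le (p * c * c), Nat.zero_le (p * L * c),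
    Nat.zero_le (L * c)]

/-- `(L+c)^c · (L+d)² ≤ (L+d)^d` for `d = c + 3κ + 7`. [folklore] -/
theorem arsenal_pow_lower (L c κ : ℕ) :
    (L + c) ^ c * (L + (c + 3 * κ + 7)) ^ 2 ≤ (L + (c + 3 * κ + 7)) ^ (c + 3 * κ + 7) := by
  have h1 : (L + c) ^ c ≤ (L + (c + 3 * κ + 7)) ^ c := Nat.pow_le_pow_left (by omega) c
  have h2 : (L + (c + 3 * κ + 7)) ^ 2 ≤ (L + (c + 3 * κ + 7)) ^ (3 * κ + 7) :=
    Nat.pow_le_pow_right (by omega) (by omega)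
  calc (L + c) ^ c * (L + (c + 3 * κ + 7)) ^ 2
      ≤ (L + (c + 3 * κ + 7)) ^ c * (L + (c + 3 * κ + 7)) ^ (3 * κ + 7) := Nat.mul_le_mul h1 h2
    _ = (L + (c + 3 * κ + 7)) ^ (c + 3 * κ + 7) := by rw [← pow_add]; ring_nf

/-- `(n + 2) (2^B + 3) ≤ 2^(log₂ n + B + 4)`. [folklore] -/
theorem arsenal_base_le (n B : ℕ) : (n + 2) * (2 ^ B + 3) ≤ 2 ^ (Nat.log 2 n + B + 4) := by
  have hn : n < 2 ^ (Nat.log 2 n + 1) := Nat.lt_pow_succ_log_self one_lt_two n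
  have h1 : n + 2 ≤ 2 ^ (Nat.log 2 n + 2) := by rw [pow_succ]; omega
  have h2 : 2 ^ B + 3 ≤ 2 ^ (B + 2) := by
    have : 1 ≤ 2 ^ B := Nat.one_le_two_pow
    rw [pow_add]; omega
  calc (n + 2) * (2 ^ B + 3) ≤ 2 ^ (Nat.log 2 n + 2) * 2 ^ (B + 2) := Nat.mul_le_mul h1 h2
    _ = 2 ^ (Nat.log 2 n + B + 4) := by rw [← pow_add]; ring_nf

/-- **The arithmetic of the arsenal.**  With `d = c + 3κ + 7`: for all `n` and all
`b ≥ (log₂ n + d)^d`, `((n+2)(2^{(log₂ n + c)^c} + 3))^κ < 2^{b/3}` and `6 ≤ b`. [folklore] -/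
theorem arsenal_arith (c κ n b : ℕ) (hb : (Nat.log 2 n + (c + 3 * κ + 7)) ^ (c + 3 * κ + 7) ≤ b) :
    ((n + 2) * (2 ^ ((Nat.log 2 n + c) ^ c) + 3)) ^ κ < 2 ^ (b / 3) ∧ 6 ≤ b := by
  have hkey := (arsenal_key_ineq (Nat.log 2 n) c κ).trans
    ((arsenal_pow_lower (Nat.log 2 n) c κ).trans hb)
  refine ⟨?_, ?_⟩
  · have hexp : (Nat.log 2 n + (Nat.log 2 n + c) ^ c + 4) * κ < b / 3 := by
      rw [Nat.lt_iff_add_one_le, Nat.le_div_iff_mul_le (by norm_num)]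
      exact hkey
    calc ((n + 2) * (2 ^ ((Nat.log 2 n + c) ^ c) + 3)) ^ κ
        ≤ (2 ^ (Nat.log 2 n + (Nat.log 2 n + c) ^ c + 4)) ^ κ :=
          Nat.pow_le_pow_left (arsenal_base_le n _) κ
      _ = 2 ^ ((Nat.log 2 n + (Nat.log 2 n + c) ^ c + 4) * κ) := by rw [← pow_mul]
      _ < 2 ^ (b / 3) := Nat.pow_lt_pow_right (by norm_num) hexp
  · have h7 : c + 3 * κ + 7 ≤ (Nat.log 2 n + (c + 3 * κ + 7)) ^ (c + 3 * κ + 7) :=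
      le_trans (by omega) (Nat.le_self_pow (by omega) (Nat.log 2 n + (c + 3 * κ + 7)))
    omega

/-! ### Sums of permutation-pattern monomials have the support of the permanent -/

section Support

variable {ι : Type*} [Fintype ι]

/-- `∏_i X_{(i, τ i)} = x^{Σ_i e_{(i, τ i)}}`. [folklore] -/
theorem prod_X_eq_monomial (τ : ι → ι) :
    ∏ i, (X (i, τ i) : MvPolynomial (ι × ι) ℝ≥0) =
      monomial (∑ i, Finsupp.single (i, τ i) 1) (1 : ℝ≥0) := by
  rw [monomial_sum_one]; rfl

/-- For a permutation `ρ`: `Σ_i e_{(i, ρ⁻¹ i)} = μ_ρ` (`permMonomial ρ = Σ_c e_{(ρ c, c)}`).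
[folklore] -/
theorem sum_single_symm_eq_permMonomial (ρ : Equiv.Perm ι) :
    (∑ i, Finsupp.single (i, ρ.symm i) (1 : ℕ)) = permMonomial ρ := by
  unfold permMonomial
  rw [← Equiv.sum_comp ρ (fun i => Finsupp.single (i, ρ.symm i) (1 : ℕ))]
  simp

/-- A bijection `τ` gives the permutation monomial of the inverse permutation. [folklore] -/
theorem sum_single_eq_permMonomial_of_bijective {τ : ι → ι} (hτ : Function.Bijective τ) :
    (∑ i, Finsupp.single (i, τ i) (1 : ℕ)) = permMonomial (Equiv.ofBijective τ hτ).symm := by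
  rw [← sum_single_symm_eq_permMonomial]
  simp

/-- **Support lemma.**  Over `ℝ≥0`, a sum `Σ_{s ∈ S} ∏_i X_{(i, F s i)}` in which every `F s`
(`s ∈ S`) is a bijection and every permutation of `ι` occurs as some `F s` has exactly the support
of `per_ι` (no cancellation; the multiplicities are irrelevant). [folklore] -/
theorem support_sum_prod_X_eq_perPoly [DecidableEq ι] {α : Type*} (S : Finset α) (F : α → ι → ι)
    (hbij : ∀ s ∈ S, Function.Bijective (F s))
    (hsurj : ∀ ρ : Equiv.Perm ι, ∃ s ∈ S, F s = ρ) :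
    (∑ s ∈ S, ∏ i, (X (i, F s i) : MvPolynomial (ι × ι) ℝ≥0)).support =
      (perPoly ι ℝ≥0).support := by
  classical
  simp_rw [prod_X_eq_monomial]
  rw [support_sum_monomial_one, support_perPoly_univ]
  ext d
  simp only [Finset.mem_image, Finset.mem_univ, true_and]
  constructor
  · rintro ⟨s, hs, rfl⟩
    exact ⟨(Equiv.ofBijective (F s) (hbij s hs)).symm,
      (sum_single_eq_permMonomial_of_bijective (hbij s hs)).symm⟩
  · rintro ⟨ρ, rfl⟩
    obtain ⟨s, hs, hF⟩ := hsurj ρ.symm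
    refine ⟨s, hs, ?_⟩
    rw [hF, sum_single_symm_eq_permMonomial]

end Support

/-! ### The lower bound from a per-support projection -/

/-- **The vocabulary-free arsenal.**  For all `c κ` there are `d n₁` (namely `d = c + 3κ + 7`,
`n₁ = 0`) such that for `n ≥ n₁` and `b ≥ (log₂ n + d)^d`, every polynomial `p` in the `n × n`
matrix variables over `ℝ≥0` admitting a projection `q` in the `b × b` matrix variables with the
support of `per_b` satisfies `((n+2)(2^{(log₂ n + c)^c} + 3))^κ < L(p)`: projections are free,
`2^{b/3} ≤ L(q)` by Jerrum–Snir-by-support (`two_pow_le_complexity_of_support_eq_perPoly`), and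
`arsenal_arith`. [folklore] -/
theorem complexity_gt_of_perSupport_projection :
    ∀ c κ : ℕ, ∃ d n₁ : ℕ, ∀ n ≥ n₁, ∀ b : ℕ, (Nat.log 2 n + d) ^ d ≤ b →
      ∀ (p : MvPolynomial (Fin n × Fin n) ℝ≥0),
        (∃ q : MvPolynomial (Fin b × Fin b) ℝ≥0,
          IsProjection q p ∧ q.support = (perPoly (Fin b) ℝ≥0).support) →
        ((n + 2) * (2 ^ ((Nat.log 2 n + c) ^ c) + 3)) ^ κ < complexity p := by
  intro c κ
  refine ⟨c + 3 * κ + 7, 0, fun n _ b hb p ⟨q, hproj, hsupp⟩ => ?_⟩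
  obtain ⟨hlt, h6⟩ := arsenal_arith c κ n b hb
  have hcard : 6 ≤ Fintype.card (Fin b) := by simpa using h6
  have hq := two_pow_le_complexity_of_support_eq_perPoly hcard hsupp
  rw [Fintype.card_fin] at hq
  exact hlt.trans_le (hq.trans (complexity_le_of_isProjection hproj))

end Summit.ValiantsHypothesis.ValiantsHypothesis.Theorems.DivisionGapPerDivisionHard

end
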